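import Literature.Probability.Percolation.TriRSWSeed
import HarnessLib

/-!
# `ν = 4/3` for site percolation on `𝕋`: the leaves after the two-scale RSW theorem

Topic `Literature/Probability/Percolation`; family `crit-perc`. Book-keeping file for the fact
`Literature.Probability.Percolation.triCorrLength_exponent` (Smirnov–Werner 2001, Thm. 1
(iii)–(iv): `ξ(p) = |p - 1/2|^{-4/3 + o(1)}`). Before this series the exponent followed from four
named facts (`TriRSWSeed.triCorrLength_exponent_of_leaves`): the four-arm exponent
`fourArm_exponent`, the near-critical pivotal count `Werner2009_lemma62`, and the
Russo–Seymour–Welsh theorem at general `p` in the two forms `Nolin2008_RSW` (positivity, aspect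
ratio `2`) and `Nolin2008_RSW_one` (crossing probabilities `→ 1`). The positivity form is no
longer needed: its only use, the chained lower bound below `L_ε(p)` behind `ξ_rad ≳ L_ε`, is now
proved from the two-scale RSW theorem `TriHexagon.triLRCrossingProb_two_scale`
(`TriRSWTwoScale.lean`, Bollobás–Riordan's Lemma 4 / Cor. 5 in lattice hexagons, every density;
`NearCriticalCorrelationLengthLower.exists_pow_le_triLRCrossingProb_holds`). Hence

* `triCorrLength_exponent_of_leaves₃ : fourArm_exponent → Werner2009_lemma62 →
  Nolin2008_RSW_one → triCorrLength_exponent`.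

A second section (2026-08-15) does the same book-keeping for the all-`ε` radius decay
`Nolin2008_radius_decay` (`NearCriticalCorrelationLength.lean`): `Nolin2008_RSW_one` gives it at
every `ε ≤ ε₀` (`Nolin2008_radius_decay_at_of_RSW_one`), and the extension to all `ε ∈ (0, 1/2)` is
reduced, as in Nolin's proof of Lemma 39 [arXiv: Lemma 37], to the upper half `L_{ε₀} ≤ C L_ε` of
the equivalence of lengths (EJP Cor. 37 = arXiv Cor. 35, not in the tree):
`Nolin2008_lemma39_at_of_charLength_le`, `Nolin2008_radius_decay_of_RSW_one_of_comparable`.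

## References

* S. Smirnov, W. Werner, *Critical exponents for two-dimensional percolation*, Math. Res. Lett.
  8 (2001) 729–744, Thm. 1 (iii)–(iv) [SmirnovWernerMRL2001].
* P. Nolin, *Near-critical percolation in two dimensions*, EJP 13 (2008), §3.1, §7 [Nolin2008].
* B. Bollobás, O. Riordan, *Percolation*, CUP (2006), Ch. 3, Lemma 4, Cor. 5 [BollobasRiordan2006].

## Mathlib / tree

Tree: `triCorrLength_exponent_of_lemma39_at` (`NearCriticalCorrelationLengthLower.lean`),
`Nolin2008_lemma39_at_of_RSW_one` (`NearCriticalExpDecay.lean`),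
`Nolin2008_radius_decay_supercritical_at_of_lemma39_at` (`NearCriticalFiniteClusterDecay.lean`),
`Nolin2008_prop34_of_expDecay` (`KestenRelationRussoProofs.lean`),
`BollobasRiordan2006_tri_expDecay_holds` (`TriSubcriticalCrossingProofs.lean`),
(the printed-RSW form `fourArm_exponent → Werner2009_lemma62 → Nolin2008_RSW_thm →
triCorrLength_exponent` is already the tree's `TriRSWSeed.triCorrLength_exponent_of_leaves'`).
-/

noncomputable section

namespace Literature.Probability.Percolation

/-- **`ν = 4/3` from three leaves.** The correlation-length exponent `triCorrLength_exponent`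
follows from the four-arm exponent `fourArm_exponent`, the near-critical pivotal count
`Werner2009_lemma62` and the "moreover" part `Nolin2008_RSW_one` of Nolin's RSW theorem; Kesten's
relation `Nolin2008_prop34` comes from `Nolin2008_prop34_of_expDecay`, Nolin's Lemma 39 at small
`ε` from `Nolin2008_lemma39_at_of_RSW_one`, and the rest (`ξ_rad ≍ L_ε`) is unconditional
(`triCorrLength_exponent_of_lemma39_at`). [cite: SmirnovWernerMRL2001, Thm. 1 (iii)–(iv) and the paragraph following it] [cite: Nolin2008, §7.3 Prop. 34, §7.4 Lemma 39 (arXiv: Prop. 32, Lemma 37)] [cite: BollobasRiordan2006, Ch. 3 Lemma 4, Cor. 5] -/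
theorem triCorrLength_exponent_of_leaves₃ (h₄ : fourArm_exponent) (h62 : Werner2009_lemma62)
    (hRSW1 : Nolin2008_RSW_one) : triCorrLength_exponent := by
  obtain ⟨ε₀, hε₀, h37⟩ := Nolin2008_lemma39_at_of_RSW_one hRSW1
  have h37' : Nolin2008_lemma39_at (min ε₀ (1 / 4)) := h37 _ (min_le_left _ _)
  exact triCorrLength_exponent_of_lemma39_at h₄
    (Nolin2008_prop34_of_expDecay BollobasRiordan2006_tri_expDecay_holds h62)
    (lt_min hε₀ (by norm_num)) (lt_of_le_of_lt (min_le_right _ _) (by norm_num)) h37'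
    (Nolin2008_radius_decay_supercritical_at_of_lemma39_at h37')

/-- **`ν = 4/3` from the four-arm exponent, Kesten's relation and uniform exponential decay at
one `ε`**, no RSW hypothesis at all: `fourArm_exponent → Nolin2008_prop34 →
Nolin2008_lemma39_at ε → triCorrLength_exponent`. [cite: Nolin2008, §7.2 Thm. "Critical exponents" (arXiv: Thm. 31), §7.4 Lemma 39 (arXiv: Lemma 37)] [cite: BollobasRiordan2006, Ch. 3 Lemma 4, Cor. 5] -/
theorem triCorrLength_exponent_of_lemma39_at' (h₄ : fourArm_exponent) (hK : Nolin2008_prop34)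
    {ε : ℝ} (hε : 0 < ε) (hε' : ε < 1 / 2) (h37 : Nolin2008_lemma39_at ε) : triCorrLength_exponent :=
  triCorrLength_exponent_of_lemma39_at h₄ hK hε hε' h37
    (Nolin2008_radius_decay_supercritical_at_of_lemma39_at h37)


/-! ### The radius decay beyond `L_ε` for every `ε` (`Nolin2008_radius_decay`): its remaining leaves

`Nolin2008_radius_decay` (`NearCriticalCorrelationLength.lean`) asserts the radius decay of the
finite cluster of the origin beyond `k · L_ε(p)` for EVERY `ε ∈ (0, 1/2)`. Both of its halves at a
fixed `ε` follow from Nolin's Lemma 39 / Remark 40 at that `ε`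
(`Nolin2008_radius_decay_at_of_lemma39_at'`, `NearCriticalFiniteClusterDecay.lean`), and Lemma 39 is
proved in the tree for `ε ≤ ε₀` from `Nolin2008_RSW_one` (`Nolin2008_lemma39_at_of_RSW_one`,
`NearCriticalExpDecay.lean`) — exactly the range of Nolin's own block argument (arXiv 0711.4948,
end of the proof of Lemma 37 = EJP Lemma 39: "Hence, we have proved the property for any `ε` below
some fixed value `ε₀` (given by RSW). The result for any `ε ∈ (0, 1/2)` follows readily by using
the equivalence of lengths for different values of `ε` (Corollary 35)"; and the paragraph after the
proof: the exponential decay "could thus have been derived much earlier – but only for values of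
`ε` small enough"). The extension to all `ε ∈ (0, 1/2)` therefore rests on the equivalence of
lengths `L_ε ≍ L_{ε'}` (EJP Cor. 37 = arXiv Cor. 35), which Nolin derives from Kesten's relation
(EJP Prop. 34, the tree's `Nolin2008_prop34`), the quasi-multiplicativity of `π₄` and the a priori
bound `π₄(n, N) ≥ C (n/N)^{2-α'}` from the five-arm exponent; conversely the radius decay at every
`ε` gives back the upper half `L_{ε'} ≤ C' L_ε` of that equivalence, through the proved bounds
`L_{ε'}(p)/C ≤ ξ_rad(p)` (`charLength_div_le_triCorrLength_le_holds`) and `ξ_rad(p) ≤ 2 L_ε(p)/c`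
(`triCorrLength_sandwich`) — a comparison which the block argument alone yields "still only for
`ε, ε'` less than some fixed value" (Nolin, loc. cit.). The implication `Nolin2008_lemma39 →
Nolin2008_radius_decay` from the tree's all-`ε` named fact is
`Nolin2008_radius_decay_of_lemma39` (`NearCriticalCorrelationLengthProofs.lean`, where the
monotonicity of these statements in `ε` is also recorded). The theorems below record the rest of
the DAG as proved implications: `Nolin2008_RSW_one →` the radius decay at every `ε ≤ ε₀`; Lemma 39
at `ε₀` and `L_{ε₀} ≤ C L_ε` near `1/2` `→` Lemma 39 at `ε ≥ ε₀` (Nolin's "follows readily"); and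
hence `Nolin2008_RSW_one` together with the equivalence of lengths `→ Nolin2008_radius_decay`.
-/

/-- **The radius decay at every small `ε` from the Russo–Seymour–Welsh theorem alone**: if
`Nolin2008_RSW_one` holds then there is `ε₀ > 0` such that `Nolin2008_radius_decay_at ε` holds for
every `ε ≤ ε₀` (Lemma 39 / Remark 40 at `ε ≤ ε₀` by Nolin's block argument,
`Nolin2008_lemma39_at_of_RSW_one`, then the two halves of the radius decay,
`Nolin2008_radius_decay_at_of_lemma39_at'`). This is the part of `Nolin2008_radius_decay` that
Nolin proves before invoking the equivalence of lengths. [cite: Nolin2008, §7.4 proof of Lemma 39 (arXiv 0711.4948: Lemma 37), §7.5 proof of Lemma 44 (arXiv: Lemma 42)] -/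
theorem Nolin2008_radius_decay_at_of_RSW_one (hRSW1 : Nolin2008_RSW_one) :
    ∃ ε₀ : ℝ, 0 < ε₀ ∧ ∀ ε : ℝ, ε ≤ ε₀ → Nolin2008_radius_decay_at ε := by
  obtain ⟨ε₀, hε₀, h37⟩ := Nolin2008_lemma39_at_of_RSW_one hRSW1
  exact ⟨ε₀, hε₀, fun ε hε => Nolin2008_radius_decay_at_of_lemma39_at' (h37 ε hε)⟩

/-- **Lemma 39 at `ε` from Lemma 39 at a smaller `ε₀` and the equivalence of lengths** (Nolin 2008,
end of the proof of Lemma 39 [arXiv: Lemma 37]: "The result for any `ε ∈ (0, 1/2)` follows readily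
by using the equivalence of lengths for different values of `ε` (Corollary 35 [EJP: Cor. 37])").
If `0 < ε₀ ≤ ε`, if `Nolin2008_lemma39_at ε₀` holds, and if `L_{ε₀}(p) ≤ C · L_ε(p)` for all
`p ∈ (1/2 - δ, 1/2)` (the upper half of `L_ε ≍ L_{ε₀}`; the lower half `L_ε ≤ L_{ε₀}` is automatic,
`charLength_anti`), then `Nolin2008_lemma39_at ε` holds, with `C₂` divided by a constant (for
`ε ≥ 1/2` both sides are vacuous, `L_ε ≡ 0`): for
`p ≤ 1/2 - δ` the length `L_{ε₀}(p)` is bounded by its value at one parameter `t₀ ∈ (1/2 - δ, 1/2)`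
(`charLength_le_charLength`), so `L_{ε₀}(p) ≤ K · L_ε(p)` for ALL `p < 1/2` with `L_ε(p) ≥ 1`, and
`e^{-C₂ n / L_{ε₀}} ≤ e^{-(C₂/K) n / L_ε}`. (The finiteness of `L_{ε₀}`, Nolin's §2.2, is supplied by
the tree's `BollobasRiordan2006_tri_expDecay_holds` through `Nolin2008_subcritical_crossing_of_expDecay`.) [cite: Nolin2008, §7.4, proof of Lemma 39, last paragraph (arXiv 0711.4948: Lemma 37), and §7.3 Cor. 37 (arXiv: Cor. 35)] -/
theorem Nolin2008_lemma39_at_of_charLength_le {ε₀ ε : ℝ} (hε₀ : 0 < ε₀) (hle : ε₀ ≤ ε)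
    (h37 : Nolin2008_lemma39_at ε₀) {C δ : ℝ} (hδ : 0 < δ)
    (hcomp : ∀ p : unitInterval, 1 / 2 - δ < (p : ℝ) → (p : ℝ) < 1 / 2 →
      (charLength ε₀ p : ℝ) ≤ C * charLength ε p) :
    Nolin2008_lemma39_at ε := by
  have hsub : Nolin2008_subcritical_crossing :=
    Nolin2008_subcritical_crossing_of_expDecay BollobasRiordan2006_tri_expDecay_holds
  -- a reference parameter `t₀ ∈ (1/2 - δ, 1/2)` and the bound `M = L_{ε₀}(t₀)` far from `1/2`
  set s : ℝ := min (δ / 2) (1 / 4) with hs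
  have hs0 : 0 < s := lt_min (by linarith) (by norm_num)
  have hsδ : s < δ := lt_of_le_of_lt (min_le_left _ _) (by linarith)
  have hs4 : s ≤ 1 / 4 := min_le_right _ _
  have ht₀I : (1 / 2 - s : ℝ) ∈ Set.Icc (0 : ℝ) 1 := by constructor <;> linarith
  set t₀ : unitInterval := ⟨1 / 2 - s, ht₀I⟩ with ht₀
  have ht₀lt : ((t₀ : unitInterval) : ℝ) < 1 / 2 := by simp only [ht₀]; linarith
  have ht₀gt : 1 / 2 - δ < ((t₀ : unitInterval) : ℝ) := by simp only [ht₀]; linarith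
  set M : ℕ := charLength ε₀ t₀ with hM
  -- one constant `K ≥ 1` with `L_{ε₀}(p) ≤ K L_ε(p)` for all `p < 1/2` with `L_ε(p) ≥ 1`
  set K : ℝ := max (max C M) 1 with hK
  have hK1 : 1 ≤ K := le_max_right _ _
  have hKpos : 0 < K := lt_of_lt_of_le one_pos hK1
  have hCK : C ≤ K := (le_max_left _ _).trans (le_max_left _ _)
  have hMK : (M : ℝ) ≤ K := (le_max_right _ _).trans (le_max_left _ _)
  have hcompK : ∀ p : unitInterval, (p : ℝ) < 1 / 2 → 1 ≤ charLength ε p →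
      1 ≤ charLength ε₀ p ∧ (charLength ε₀ p : ℝ) ≤ K * charLength ε p := by
    intro p hp hL
    have hanti : charLength ε p ≤ charLength ε₀ p := charLength_anti hsub hε₀ hle hp.ne
    refine ⟨hL.trans hanti, ?_⟩
    have hL1 : (1 : ℝ) ≤ charLength ε p := by exact_mod_cast hL
    by_cases hnear : 1 / 2 - δ < (p : ℝ)
    · calc (charLength ε₀ p : ℝ) ≤ C * charLength ε p := hcomp p hnear hp
        _ ≤ K * charLength ε p := mul_le_mul_of_nonneg_right hCK (by positivity)
    · have hpt : p ≤ t₀ := Subtype.coe_le_coe.1 (by push Not at hnear; linarith)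
      have hfar : charLength ε₀ p ≤ M := charLength_le_charLength hsub hε₀ hpt ht₀lt
      calc (charLength ε₀ p : ℝ) ≤ M := by exact_mod_cast hfar
        _ ≤ K := hMK
        _ = K * 1 := (mul_one K).symm
        _ ≤ K * charLength ε p := mul_le_mul_of_nonneg_left hL1 hKpos.le
  -- transfer of the bound
  intro k hk
  obtain ⟨C₁, hC₁, C₂, hC₂, hb⟩ := h37 k hk
  refine ⟨C₁, hC₁, C₂ / K, div_pos hC₂ hKpos, fun p hp hL n => ?_⟩
  obtain ⟨hL₀, hcmp⟩ := hcompK p hp hL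
  have hL₀pos : (0 : ℝ) < charLength ε₀ p := by exact_mod_cast hL₀
  have hLpos : (0 : ℝ) < charLength ε p := by exact_mod_cast hL
  calc triLRCrossingProb p n (k * n) ≤ C₁ * Real.exp (-(C₂ * n / charLength ε₀ p)) := hb p hp hL₀ n
    _ ≤ C₁ * Real.exp (-(C₂ / K * n / charLength ε p)) := by
        refine mul_le_mul_of_nonneg_left (Real.exp_le_exp.2 (neg_le_neg ?_)) hC₁.le
        calc C₂ / K * n / charLength ε p = C₂ * n / (K * charLength ε p) := by
              field_simp
          _ ≤ C₂ * n / charLength ε₀ p :=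
              div_le_div_of_nonneg_left (by positivity) hL₀pos hcmp

/-- **`Nolin2008_radius_decay` from the Russo–Seymour–Welsh theorem and the equivalence of lengths.**
If `Nolin2008_RSW_one` holds (whence Lemma 39 for `ε ≤ ε₀`, `Nolin2008_lemma39_at_of_RSW_one`) and
if for all `0 < ε₀ ≤ ε < 1/2` the lengths compare as `L_{ε₀}(p) ≤ C L_ε(p)` on a left
neighbourhood `(1/2 - δ, 1/2)` of `1/2` (the upper half of Nolin's Cor. 37 [arXiv: Cor. 35],
`L_ε ≍ L_{ε'}`, in the form needed; any two-sided version on a punctured neighbourhood of `1/2`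
implies it), then the radius decay beyond `L_ε` holds for every `ε ∈ (0, 1/2)`: for `ε ≤ ε₀`
directly, for `ε > ε₀` through `Nolin2008_lemma39_at_of_charLength_le`, and in both cases both
halves by `Nolin2008_radius_decay_at_of_lemma39_at'`. This is the printed proof of
`Nolin2008_radius_decay` with its two remaining inputs displayed as hypotheses. [cite: Nolin2008, §7.4 Lemma 39 with its proof's last paragraph, §7.3 Cor. 37, §7.5 proof of Lemma 44 (arXiv 0711.4948: Lemma 37, Cor. 35, Lemma 42)] -/
theorem Nolin2008_radius_decay_of_RSW_one_of_comparable (hRSW1 : Nolin2008_RSW_one)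
    (hcomp : ∀ ε₀ ε : ℝ, 0 < ε₀ → ε₀ ≤ ε → ε < 1 / 2 → ∃ C δ : ℝ, 0 < δ ∧
      ∀ p : unitInterval, 1 / 2 - δ < (p : ℝ) → (p : ℝ) < 1 / 2 →
        (charLength ε₀ p : ℝ) ≤ C * charLength ε p) :
    Nolin2008_radius_decay := by
  obtain ⟨ε₁, hε₁, h37⟩ := Nolin2008_lemma39_at_of_RSW_one hRSW1
  intro ε hε hε'
  by_cases hsmall : ε ≤ ε₁
  · exact Nolin2008_radius_decay_at_of_lemma39_at' (h37 ε hsmall)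
  · obtain ⟨C, δ, hδ, hc⟩ := hcomp ε₁ ε hε₁ (not_le.1 hsmall).le hε'
    exact Nolin2008_radius_decay_at_of_lemma39_at'
      (Nolin2008_lemma39_at_of_charLength_le hε₁ (not_le.1 hsmall).le (h37 ε₁ le_rfl) hδ hc)

end Literature.Probability.Percolation
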